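import Summits.QuantumFields.YangMills.Theorems.UnitScaleTiltProp7CombFrameRem2TopT3
import Summits.QuantumFields.YangMills.Theorems.UnitScaleTiltProp7CombFrameLinearResponseStepT3
import Summits.QuantumFields.YangMills.Theorems.UnitScaleTiltProp7CombTreeRatioLinearResponse
import HarnessLib

/-!
# Route `UnitScaleTilt`, crux K1 «MinimiserStabilityRegPr» (stmt-QuantumFields-19200), route-R E′ (A′)-on-Σ, P-A2 (β), R0 ∕ REM2ᶜ — file F-γᶜ3b «REM2ᶜ AT THE TOP, `ℓ := fderiv`»:
# **`Σ_{y : Site (F.P n) 0} ‖w_{iX}(y) − 1 − D(w_{·}(y))(0)[iX]‖ ≤ 2L·(477L²·Am + 3L·Am₂ + 49·220L³·Am)·ℓ⁻¹ + (477L²·Bm + 3L·Bm₂ + 49·110L²·Bm)·ℓ`** — ✓px13 `Prop7R0OfFrameRows.siteRow_of_frameRows`'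
# row `hrc` SUMMED, i.e. REM2ᶜ in the E2E two-slot currency, UNDER EXACTLY the two admitted route-internal rows `hMcomb` (SIGNATURE-0 2f7f2fca) and `hMcomb₂` (SIGNATURE-0′ 53b55878), both TOKEN
# FOR TOKEN at `A := fun b ↦ I•X b`, plus the kinematic differentiability rows `hT`∕`hF` of ★routeR-w2 ✓p702200 (discharged at `RegPr` by their (2ᶜ))

Cell `ym3-torus` (HUMAN RULING D-0037: YM₃ on the torus is ladder rung R3 — not d = 4, not a mass gap, not Clay), width seat `ym3-torus-px17` (gen 4); ★★OWNER RULINGS №19 (3) ∕ №20 (1).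
`--supports stmt-QuantumFields-19200 --as helper`; THEOREMS ONLY (0 `def`, 0 `sorry`); count-neutral.  «route-internal rows (n3)-comb ∕ (n3)-comb₂ — NOT N06, NOT print rows; OPEN; RULINGS №19 O4 ∕ №20 (1)».
Nothing of `hMcomb`, `hMcomb₂`, (β), `hPA2`, `hcoS`, E′, EX, the crux, d = 4 or the gap is claimed.

THE IDENTIFICATION.  In F-γᶜ3 (✓`Prop7CombFrameRem2TopT3.combFrameRem2_top_of_hMcomb`) take `ℓ l x̂ := fderiv ℂ (A′ ↦ ↑(vcov L W♯ (e^{A′})♯ l x̂)) 0 (iX)` and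
`ℓY l x̂ κ := fderiv ℂ (A′ ↦ ↑(tildIter L W♯ (e^{A′})♯ l x̂ κ)) 0 (iX)` (`W♯ = pull (bgUnits W) x₀`, `(e^{A′})♯ = pull (fun b ↦ expUnit (A′ b)) x₀`, base point `(e^{0})♯ = 1` ✓`comb_family_zero`):
`hℓ0` is `vcov_zero`; the displayed recursion `hℓ` is ★routeR-w2 ✓`Prop7CombFrameLinearResponseStep.fderiv_coe_vcov_succ_apply` with its tree-ratio summand read by ★routeR-w2
✓`Prop7CombTreeRatioLinearResponse.fderiv_combTreeRatio_apply` as `tsum Ū₀ˡ (ℓY l) (L•ẑ) Γ_r`; `hD` becomes `hMcomb₂`'s summand (✓`pull_expUnit_eq_expCfg`) and `hDs` IS `hMcomb₂`; the top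
`ℓ (K−n) (coordT3 y)` is `fderiv ℂ (A′ ↦ ↑(frameTw W A′ y)) 0 (iX)` by ✓`fderiv_frameTw_eq_fderiv_vcov`.

WHAT IS PROVED (ns `…Theorems.Prop7CombFrameRem2TopFderivT3`): ★★★ `sum_norm_frameTw_sub_one_sub_fderiv_le_of_hMcomb₂` (the title).
HONEST SCOPE.  Bookkeeping over F-γᶜ3 and ★routeR-w2's calculus; the analytic content is the displayed `hMcomb` (XL) + `hMcomb₂` (L); `hT`∕`hF` are kinematic (★routeR-w2 (2ᶜ) discharges them
at `RegPr`); nothing of print asserted; rung R3, not Clay; YM gap NOT proved.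

References: T. Bałaban, CMP **98** (1985) 17–51 [Balaban1985Averaging] ((58) p.27, (82) p.30, (97) p.32, (111) p.34, Prop. 3 (122)–(126) p.36); CMP **99** (1985) 389–434
[Balaban1985BackgroundPropagators] ((3.14) p.393); CMP **102** (1985) 277–309 [Balaban1985Variational] ((44) p.285); CMP **109** (1987) 249–301 [Balaban1987RG1] ((0.3)–(0.4) pp.252–253).
-/

set_option autoImplicit false

noncomputable section

open scoped BigOperators Matrix.Norms.L2Operator

namespace Summit.QuantumFields.YangMills.Theorems.Prop7CombFrameRem2TopFderivT3

open Finset NormedSpace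
open Literature.MathematicalPhysics.QuantumFieldTheory.Balaban1983to89
open Literature.MathematicalPhysics.QuantumFieldTheory.Balaban1983to89.T3ContinuumYM3Torus
open T4Continuum BlockAveraging
open T3PrintedRegularMinimiser (RegPr)
open T3SectALandauChart (eta eta_pos bgUnits)
open B7Prop1Explicit renaming Site → LSite
open B7Prop1Explicit (hol treeWord boxVec expUnit)
open B7Prop2Explicit (avgIter)
open B7Prop3Flat (expCfg)
open B7Eq92Concrete (tHol tildIter vcov vcov_zero)
open B7Prop3GeneralRotated renaming tsum → covTsum
open B10Eq27TorusAxialLog (pull pull_apply transl)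
open Summit.QuantumFields.YangMills.Theorems.Prop7SPrint (basePt)
open Summit.QuantumFields.YangMills.Theorems.Prop7TPrint (nMax19)
open Summit.QuantumFields.YangMills.Theorems.Prop7SymAvgTw (coordT3 frameTw)
open Summit.QuantumFields.YangMills.Theorems.Prop7SymAvgTwFrameDiff (frameTw_eq_vcov pull_expUnit_eq_expCfg)
open Summit.QuantumFields.YangMills.Theorems.Prop7CombFrameRem2TopT3 (combFrameRem2_top_of_hMcomb)
open Summit.QuantumFields.YangMills.Theorems.Prop7CombFrameLinearResponseStep (fderiv_coe_vcov_succ_apply comb_family_zero fderiv_frameTw_eq_fderiv_vcov)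
open Summit.QuantumFields.YangMills.Theorems.Prop7CombTreeRatioLinearResponse (fderiv_combTreeRatio_apply)

section Member

variable (F : T3Family) {n K : ℕ} (h : n ≤ K)

set_option maxHeartbeats 400000 in
/-- ★★★ **REM2ᶜ AT THE TOP WITH THE FRÉCHET DERIVATIVE AS THE LINEAR PART** (R0-DOOR's `hrc` summed): member `(F, n ≤ K)`, `W ∈ 𝔘_k(ε₀)` (`10⁷L⁴ε₀ ≤ 1`), Hermitian traceless `X` of
(19)-size `nMax19 W X < ε₀∕6`; the kinematic rows `hT`∕`hF` (differentiability at `A = 0` of the single bars and of the accumulated frames of print's comb tower along `A′ ↦ (e^{A′})♯`, every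
`l < K − n`); DISPLAYED: `hMcomb` and `hMcomb₂` TOKEN FOR TOKEN at `A := iX`.  THEN
`Σ_{y : Site (F.P n) 0} ‖↑(frameTw W (iX) y) − 1 − fderiv ℂ (A′ ↦ ↑(frameTw W A′ y)) 0 (iX)‖ ≤ 2L·(477L²·Am + 3L·Am₂ + 49·(220L³·Am))·(L^{K−n})⁻¹ + (477L²·Bm + 3L·Bm₂ + 49·(110L²·Bm))·L^{K−n}`.
[cite: Balaban1985Averaging, (82) p.30, (97) p.32, (111) p.34, Prop. 3 (122)-(126) p.36; Balaban1985BackgroundPropagators, (3.14) p.393; Balaban1985Variational, (44) p.285] -/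
theorem sum_norm_frameTw_sub_one_sub_fderiv_le_of_hMcomb₂ {ε₀ : ℝ} (hε₀ : 0 < ε₀) (hε : 10 ^ 7 * (F.L : ℝ) ^ 4 * ε₀ ≤ 1)
    (W : GaugeField (F.P K) 0 (Matrix.specialUnitaryGroup (Fin 2) ℂ)) (hreg : RegPr F n K ε₀ W)
    (X : PBond (F.P K) 0 → Matrix (Fin 2) (Fin 2) ℂ) (hX : ∀ b, (X b).IsHermitian ∧ (X b).trace = 0) (hX6 : nMax19 F n K W X < ε₀ / 6)
    (hT : ∀ l : ℕ, l < K - n → ∀ (x : LSite (F.P K).d) (κ : Fin (F.P K).d),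
      DifferentiableAt ℂ (fun A' : PBond (F.P K) 0 → Matrix (Fin 2) (Fin 2) ℂ =>
        ((tildIter (F.P K).L (pull (bgUnits F K W) (basePt F n K)) (pull (fun b => expUnit (A' b)) (basePt F n K)) l x κ : (Matrix (Fin 2) (Fin 2) ℂ)ˣ) : Matrix (Fin 2) (Fin 2) ℂ)) 0)
    (hF : ∀ l : ℕ, l < K - n → ∀ x : LSite (F.P K).d,
      DifferentiableAt ℂ (fun A' : PBond (F.P K) 0 → Matrix (Fin 2) (Fin 2) ℂ =>
        ((vcov (F.P K).L (pull (bgUnits F K W) (basePt F n K)) (pull (fun b => expUnit (A' b)) (basePt F n K)) l x : (Matrix (Fin 2) (Fin 2) ℂ)ˣ) : Matrix (Fin 2) (Fin 2) ℂ)) 0)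
    {Am Bm Am₂ Bm₂ : ℝ} (hAm : 0 ≤ Am) (hBm : 0 ≤ Bm) (hAm₂ : 0 ≤ Am₂) (hBm₂ : 0 ≤ Bm₂)
    (hMcomb : ∀ l : ℕ, l < K - n →
      ∑ z : Site (F.P K) l, ∑ κ : Fin (F.P K).d,
        ‖((tildIter (F.P K).L (pull (bgUnits F K W) (basePt F n K)) (pull (fun b => expUnit (Complex.I • X b)) (basePt F n K)) l
              (fun μ => ((z μ).val : ℤ)) κ : (Matrix (Fin 2) (Fin 2) ℂ)ˣ) : Matrix (Fin 2) (Fin 2) ℂ) - 1‖ ^ 2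
          ≤ Am * ((F.L : ℝ) ^ l)⁻¹ + Bm * (F.L : ℝ) ^ l)
    (hMcomb₂ : ∀ l : ℕ, l < K - n →
      ∑ z : Site (F.P K) l, ∑ κ : Fin (F.P K).d,
        ‖((tildIter (F.P K).L (pull (bgUnits F K W) (basePt F n K)) (pull (fun b => expUnit ((fun b => Complex.I • X b) b)) (basePt F n K)) l
              (fun μ => ((z μ).val : ℤ)) κ : (Matrix (Fin 2) (Fin 2) ℂ)ˣ) : Matrix (Fin 2) (Fin 2) ℂ) - 1
            - (fderiv ℂ (fun A' : PBond (F.P K) 0 → Matrix (Fin 2) (Fin 2) ℂ =>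
                ((tildIter (F.P K).L (pull (bgUnits F K W) (basePt F n K)) (pull (fun b => expUnit (A' b)) (basePt F n K)) l (fun μ => ((z μ).val : ℤ)) κ :
                  (Matrix (Fin 2) (Fin 2) ℂ)ˣ) : Matrix (Fin 2) (Fin 2) ℂ)) 0) (fun b => Complex.I • X b)‖
          ≤ Am₂ * ((F.L : ℝ) ^ l)⁻¹ + Bm₂ * (F.L : ℝ) ^ l) :
    ∑ y : Site (F.P n) 0, ‖((frameTw F n K h W (fun b => Complex.I • X b) y : (Matrix (Fin 2) (Fin 2) ℂ)ˣ) : Matrix (Fin 2) (Fin 2) ℂ) - 1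
        - fderiv ℂ (fun A' : PBond (F.P K) 0 → Matrix (Fin 2) (Fin 2) ℂ => ((frameTw F n K h W A' y : (Matrix (Fin 2) (Fin 2) ℂ)ˣ) : Matrix (Fin 2) (Fin 2) ℂ)) 0
            (fun b => Complex.I • X b)‖
      ≤ 2 * (F.L : ℝ) * (477 * (F.L : ℝ) ^ 2 * Am + 3 * (F.L : ℝ) * Am₂ + 49 * (220 * (F.L : ℝ) ^ 3 * Am)) * ((F.L : ℝ) ^ (K - n))⁻¹
        + (477 * (F.L : ℝ) ^ 2 * Bm + 3 * (F.L : ℝ) * Bm₂ + 49 * (110 * (F.L : ℝ) ^ 2 * Bm)) * (F.L : ℝ) ^ (K - n) := by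
  letI : CStarAlgebra (Matrix (Fin 2) (Fin 2) ℂ) := B10Eq29TubeLine.cstarAlgebraMatrix 2
  have hLpos : 0 < (F.P K).L := (F.P K).L_pos
  -- letters
  set U₀' := pull (bgUnits F K W) (basePt F n K) with hU₀'
  set B' : LSite (F.P K).d → Fin (F.P K).d → Matrix (Fin 2) (Fin 2) ℂ := fun z κ => Complex.I • X ⟨transl (basePt F n K) z, κ⟩ with hB'
  set A : PBond (F.P K) 0 → Matrix (Fin 2) (Fin 2) ℂ := fun b => Complex.I • X b with hA
  set U₁ : (PBond (F.P K) 0 → Matrix (Fin 2) (Fin 2) ℂ) → LSite (F.P K).d → Fin (F.P K).d → (Matrix (Fin 2) (Fin 2) ℂ)ˣ :=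
    fun A' => pull (fun b => expUnit (A' b)) (basePt F n K) with hU₁
  have hU₁0 : U₁ 0 = 1 := comb_family_zero F
  have hpull : pull (fun b => expUnit (Complex.I • X b)) (basePt F n K) = expCfg B' := pull_expUnit_eq_expCfg F (fun b => Complex.I • X b) (basePt F n K)
  -- the linear parts := the Fréchet derivatives at `0` in the direction `iX`
  set ℓ : ℕ → LSite (F.P K).d → Matrix (Fin 2) (Fin 2) ℂ := fun l x =>
    fderiv ℂ (fun A' : PBond (F.P K) 0 → Matrix (Fin 2) (Fin 2) ℂ => ((vcov (F.P K).L U₀' (U₁ A') l x : (Matrix (Fin 2) (Fin 2) ℂ)ˣ) : Matrix (Fin 2) (Fin 2) ℂ)) 0 A with hℓdef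
  set ℓY : ℕ → LSite (F.P K).d → Fin (F.P K).d → Matrix (Fin 2) (Fin 2) ℂ := fun l x κ =>
    fderiv ℂ (fun A' : PBond (F.P K) 0 → Matrix (Fin 2) (Fin 2) ℂ => ((tildIter (F.P K).L U₀' (U₁ A') l x κ : (Matrix (Fin 2) (Fin 2) ℂ)ˣ) : Matrix (Fin 2) (Fin 2) ℂ)) 0 A with hℓYdef
  -- the link remainders (zero above the tower)
  set D : ℕ → (l : ℕ) → Site (F.P K) l → Fin (F.P K).d → ℝ := fun _ l x κ =>
    if l < K - n then ‖((tildIter (F.P K).L U₀' (expCfg B') l (fun μ => ((x μ).val : ℤ)) κ : (Matrix (Fin 2) (Fin 2) ℂ)ˣ) : Matrix (Fin 2) (Fin 2) ℂ) - 1 - ℓY l (fun μ => ((x μ).val : ℤ)) κ‖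
    else 0 with hDdef
  have hD0 : ∀ l' l x κ, 0 ≤ D l' l x κ := by
    intro l' l x κ
    rw [hDdef]; dsimp only
    split_ifs
    · exact norm_nonneg _
    · exact le_rfl
  have hD : ∀ l : ℕ, l < K - n → ∀ (x : Site (F.P K) l) (κ : Fin (F.P K).d),
      ‖((tildIter (F.P K).L U₀' (expCfg B') l (fun μ => ((x μ).val : ℤ)) κ : (Matrix (Fin 2) (Fin 2) ℂ)ˣ) : Matrix (Fin 2) (Fin 2) ℂ) - 1 - ℓY l (fun μ => ((x μ).val : ℤ)) κ‖ ≤ D l l x κ := by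
    intro l hl x κ
    rw [hDdef]; dsimp only
    rw [if_pos hl]
  have hDs : ∀ l ≤ K - n, ∑ x : Site (F.P K) l, ∑ κ : Fin (F.P K).d, D l l x κ ≤ Am₂ * ((F.L : ℝ) ^ l)⁻¹ + Bm₂ * (F.L : ℝ) ^ l := by
    intro l hl
    rw [hDdef]; dsimp only
    by_cases hlt : l < K - n
    · simp only [if_pos hlt]
      have h2 := hMcomb₂ l hlt
      rw [hpull] at h2
      exact h2
    · simp only [if_neg hlt, Finset.sum_const_zero]
      positivity
  -- `ℓ 0 = 0`
  have hℓ0 : ∀ x, ℓ 0 x = 0 := by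
    intro x
    rw [hℓdef]; dsimp only
    have hc : (fun A' : PBond (F.P K) 0 → Matrix (Fin 2) (Fin 2) ℂ => ((vcov (F.P K).L U₀' (U₁ A') 0 x : (Matrix (Fin 2) (Fin 2) ℂ)ˣ) : Matrix (Fin 2) (Fin 2) ℂ))
        = fun _ => 1 := by
      funext A'; rw [vcov_zero, Units.val_one]
    rw [hc]
    simp
  -- the recursion of the derivatives
  have hℓ : ∀ l : ℕ, l < K - n → ∀ z : Site (F.P K) (l + 1),
      ℓ (l + 1) (fun μ => ((z μ).val : ℤ))
        = ((Fintype.card (Fin (F.P K).d → Fin (F.P K).L) : ℂ))⁻¹ • ∑ r : Fin (F.P K).d → Fin (F.P K).L,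
            (covTsum (avgIter (F.P K).L U₀' l) (ℓY l) (((F.P K).L : ℤ) • (fun μ => ((z μ).val : ℤ))) (treeWord (boxVec (F.P K).L r))
              + ((hol (avgIter (F.P K).L U₀' l) (((F.P K).L : ℤ) • (fun μ => ((z μ).val : ℤ))) (treeWord (boxVec (F.P K).L r)) : (Matrix (Fin 2) (Fin 2) ℂ)ˣ) : Matrix (Fin 2) (Fin 2) ℂ)
                * ℓ l (((F.P K).L : ℤ) • (fun μ => ((z μ).val : ℤ)) + boxVec (F.P K).L r)
                * (((hol (avgIter (F.P K).L U₀' l) (((F.P K).L : ℤ) • (fun μ => ((z μ).val : ℤ))) (treeWord (boxVec (F.P K).L r)))⁻¹ : (Matrix (Fin 2) (Fin 2) ℂ)ˣ) : Matrix (Fin 2) (Fin 2) ℂ)) := by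
    intro l hl z
    rw [hℓdef]; dsimp only
    rw [fderiv_coe_vcov_succ_apply (F.P K).L U₀' U₁ hLpos hU₁0 l (hT l hl) (hF l hl) (fun μ => ((z μ).val : ℤ)) A]
    congr 1
    refine Finset.sum_congr rfl fun r _ => ?_
    rw [(fderiv_combTreeRatio_apply (F.P K).L U₀' U₁ hU₁0 l (hT l hl) (((F.P K).L : ℤ) • (fun μ => ((z μ).val : ℤ))) (treeWord (boxVec (F.P K).L r)) A).2]
  have htop := combFrameRem2_top_of_hMcomb F h hε₀ hε W hreg X hX hX6 ℓ ℓY hℓ0 hℓ D hD0 hD hAm hBm hAm₂ hBm₂ hMcomb hDs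
  -- the top linear part is the Fréchet derivative of `frameTw`
  have hℓtop : ∀ y : Site (F.P n) 0, ℓ (K - n) (coordT3 F n K h y)
      = fderiv ℂ (fun A' : PBond (F.P K) 0 → Matrix (Fin 2) (Fin 2) ℂ => ((frameTw F n K h W A' y : (Matrix (Fin 2) (Fin 2) ℂ)ˣ) : Matrix (Fin 2) (Fin 2) ℂ)) 0 A := by
    intro y
    rw [hℓdef]; dsimp only
    rw [fderiv_frameTw_eq_fderiv_vcov]
  calc _ = ∑ y : Site (F.P n) 0, ‖((frameTw F n K h W (fun b => Complex.I • X b) y : (Matrix (Fin 2) (Fin 2) ℂ)ˣ) : Matrix (Fin 2) (Fin 2) ℂ) - 1 - ℓ (K - n) (coordT3 F n K h y)‖ :=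
        Finset.sum_congr rfl fun y _ => by rw [hℓtop y]
    _ ≤ _ := htop

end Member

end Summit.QuantumFields.YangMills.Theorems.Prop7CombFrameRem2TopFderivT3

end
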